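import Literature.Barriers.PneNP.GateEliminationLimit
import Literature.Computability.Complexity.MajorityCircuit
import HarnessLib

/-!
# Barrier `GateEliminationLimit` (Golovnev–Hirsch–Knop–Kulikov 2016, Lemma 1): the printed proof, assembled

D-0014 discharge work for the named fact `Literature.Barriers.PneNP.GateEliminationLimit`
(`GateEliminationLimit.lean`): the second and third inequalities of GHKK's Lemma 1 (MFCS 2016,
PDF p. 6), "for any `m > 0`, for any function `h` of `n` inputs, `f = h ⋄ MAJ_{2m+1}`:
`gates(h) ≤ gates(f) ≤ gates(h) + 4.5(2m+1)n`; for any `m`-substitution `ρ`,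
`gates(f) − gates(f|_ρ) ≤ 4.5(2m+1)m`."

The printed proof (PDF p. 6, the `MAJ₃` case, "We then take a circuit `C'` computing
`f|_{x₁₁ ← ρ}` and use the value of a gadget computing `MAJ₃(x₁₁, x₁₂, x₁₃)` instead of `x₁₂` and
`x₁₃`. This way we suppress the effect of the substitution"; and PDF p. 7, proof of Thm. 3, the
general repair: "Since `ρ` is an `m`-substitution, there are at most `m` gadgets we need to
repair") has two parts:

* **circuit surgery**, which transfers verbatim to the tree's straight-line `B₂`-circuits and is
  PROVED here with the gadget size `gates(MAJ_{2m+1})` as a parameter: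
  `circuitSizeOver_blockCompose_le` (`gates(h ⋄ g) ≤ gates(h) + n · gates(g)`: one gadget per
  block under a circuit for `h`) and `circuitSizeOver_blockCompose_le_apply`
  (`gates(f) ≤ gates(f|_ρ) + m · gates(MAJ_{2m+1})` for `|ρ| ≤ m`: in each of the `≤ m` touched
  blocks feed a fresh gadget's value into the `≥ m + 1` untouched variables, which forces the
  block's majority — weak `m`-stability, `majFn_eq_of_card_ne_le`);
* **one imported ingredient**, the sentence "the majority of `2m + 1` bits can be computed by a
  circuit of size `4.5(2m + 1)` [8]" (PDF p. 6), i.e. `gates(MAJ_{2m+1}) ≤ 9m + 4` over `B₂`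
  (GHKK's [8]/[6] is Demenkov–Kojevnikov–Kulikov–Yaroslavtsev, IPL 110 (2010), `4.5n + o(n)` for
  every symmetric function via MDFA blocks; the bare bound follows from the bit-adder bound
  `size(SUM_n) ≤ 4.5n − 2⌈log₂(n+1)⌉`, arXiv:2509.13966 Thm. 1, plus an
  `(⌈log₂(n+1)⌉ − 1)`-gate comparison with the constant `m + 1`).

Assembly (sorry-free): `GateEliminationLimit_of_majority_bound` derives the fact with its printed
constants from the ingredient, and conversely `GateEliminationLimit.majority_bound` recovers the
ingredient from the fact (`n = 1`, `h` a projection), so `GateEliminationLimit_iff_majority_bound`: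
the barrier fact is EQUIVALENT to `∀ m ≥ 1, gates(MAJ_{2m+1}) ≤ 9m + 4`. What remains for an
unconditional `GateEliminationLimit_holds` is exactly a verified `B₂`-circuit family for
`MAJ_{2m+1}` within `9m + 4` gates (an MDFA-based bit counter plus a comparator); it is not
asserted here.

## Sources

* [GolovnevHirschKnopKulikov2016] §3.2 (PDF pp. 5–6), Lemma 1 (PDF p. 6), Def. 2 and proof of
  Thm. 3 (PDF p. 7) — held (`paper:doi-10-4230-lipics-mfcs-2016-46`).
* [Vollmer1999] §1.2 — through `CircuitComposition.lean` (`CktSize.comp`, `.pair`, `.pi_const`,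
  `.rewire`, `.outMap`, `cktSize_univ`, `CktSize.toCircuit`).
-/

noncomputable section

namespace Literature.Barriers.PneNP

open Finset Literature.Computability.Complexity

/-! ### Lemma 1 reduced to the size of the majority gadget (proved)

GHKK's own argument for Lemma 1 — attach `n` gadgets to a circuit for `h`; repair the `≤ m`
touched gadgets of a circuit for `f|_ρ` — transfers verbatim to the tree's straight-line
`B₂`-circuits and is PROVED below with the gadget size `gates(MAJ_{2m+1})` as a parameter
(`circuitSizeOver_blockCompose_le`, `circuitSizeOver_blockCompose_le_apply`). The only imported
ingredient of the printed constants is the sentence "the majority of `2m + 1` bits can be computed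
by a circuit of size `4.5(2m + 1)` [8]" (PDF p. 6), i.e. `gates(MAJ_{2m+1}) ≤ 9m + 4`; the fact
`GateEliminationLimit` is EQUIVALENT to it (`GateEliminationLimit_of_majority_bound`,
`GateEliminationLimit.majority_bound`, `GateEliminationLimit_iff_majority_bound`). -/

/-- Over `B₂` the infimum defining `circuitSizeOver B2 f` is attained (every `f` on finitely
many variables has a `B₂`-circuit, `cktSize_univ`), in the straight-line form `CktSize`.
[folklore] -/
theorem cktSize_circuitSizeOver {α : Type} [Fintype α] (f : (α → Bool) → Bool) :
    CktSize B2 (fun x (_ : Unit) => f x) (circuitSizeOver B2 f) := by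
  have hne : {s | ∃ C : Circuit α, C.IsOver B2 ∧ C.Computes f ∧ C.size = s}.Nonempty := by
    obtain ⟨C, hB, -, hC⟩ := (cktSize_univ fun (x : α → Bool) (_ : Unit) => f x).toCircuit
    exact ⟨C.size, C, hB, fun x => hC x, rfl⟩
  obtain ⟨C, hB, hC, hs⟩ := Nat.sInf_mem hne
  have hs' : C.size = circuitSizeOver B2 f := hs
  rw [← hs']
  exact cktSize_of_circuit C hB hC

/-- A straight-line realization of size `≤ s` bounds the circuit complexity by `s`
(`CktSize.toCircuit`). [folklore] -/
theorem circuitSizeOver_le_of_cktSize {α : Type} {f : (α → Bool) → Bool} {s : ℕ}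
    (h : CktSize B2 (fun x (_ : Unit) => f x) s) : circuitSizeOver B2 f ≤ s := by
  obtain ⟨C, hB, hs, hC⟩ := h.toCircuit
  exact (circuitSizeOver_le_of_computes C hB fun x => hC x).trans hs

/-- **Lemma 1, second inequality, with the gadget size as a parameter (proved)**:
`gates(h ⋄ g) ≤ gates(h) + n · gates(g)` — one circuit for `g` per block (`CktSize.pi_const`,
inputs renamed for free by `CktSize.rewire`), then a circuit for `h` on top (`CktSize.comp`).
[cite: GolovnevHirschKnopKulikov2016, Lemma 1 (PDF p. 6: "gates(f) ≤ gates(h) + 4.5(2m+1)n")] -/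
theorem circuitSizeOver_blockCompose_le {n k : ℕ} (h : (Fin n → Bool) → Bool)
    (g : (Fin k → Bool) → Bool) :
    circuitSizeOver B2 (blockCompose h g) ≤ circuitSizeOver B2 h + n * circuitSizeOver B2 g := by
  -- stage 1: the `n` gadgets, block `i` reading the variables `(i, j)`
  have h1 : CktSize B2 (fun (x : Fin n × Fin k → Bool) (i : Fin n) => g fun j => x (i, j))
      (Fintype.card (Fin n) * circuitSizeOver B2 g) :=
    CktSize.pi_const fun i => (cktSize_circuitSizeOver g).rewire fun j => (i, j)
  -- stage 2: a circuit for `h` on top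
  have h2 := h1.comp (cktSize_circuitSizeOver h)
  rw [Fintype.card_fin] at h2
  have h3 := circuitSizeOver_le_of_cktSize (f := blockCompose h g) (h2.congr fun x _ => rfl)
  omega

/-- **Weak `m`-stability of `MAJ_{2m+1}`**: if at most `m` of the `2m + 1` entries of `v` differ
from `b`, then `MAJ_{2m+1}(v) = b`. [cite: GolovnevHirschKnopKulikov2016, §3.3 (PDF p. 7: "It is easy to see that MAJ_{2m+1} is a weakly m-stable function")] -/
theorem majFn_eq_of_card_ne_le {m : ℕ} (v : Fin (2 * m + 1) → Bool) (b : Bool)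
    (hv : (univ.filter fun j => v j ≠ b).card ≤ m) : majFn (2 * m + 1) v = b := by
  have hsplit := Finset.card_filter_add_card_filter_not (s := (univ : Finset (Fin (2 * m + 1))))
    (fun j => v j = true)
  simp only [card_univ, Fintype.card_fin] at hsplit
  have hones : GateFn.numOnes v = (univ.filter fun j => v j = true).card := rfl
  rw [majFn_apply]
  cases b
  · -- at most `m` ones
    have hle : (univ.filter fun j => v j = true).card ≤ m := by
      refine le_trans (le_of_eq ?_) hv
      congr 1
      ext j
      simp
    rw [decide_eq_false_iff_not, not_le]
    omega
  · -- at most `m` zeros, hence at least `m + 1` ones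
    have hle : (univ.filter fun j => ¬ (v j = true)).card ≤ m := by
      refine le_trans (le_of_eq ?_) hv
      congr 1
    rw [decide_eq_true_eq]
    omega

/-- **Lemma 1, third inequality, with the gadget size as a parameter (proved)** — the repair
construction of §3.2/Thm. 3: from a circuit for `f|_ρ` (`f = h ⋄ MAJ_{2m+1}`, `ρ` substituting
at most `m` variables) build one for `f` by feeding, in each of the `≤ m` touched blocks, the
value of a fresh `MAJ_{2m+1}` gadget on the block's true variables into all untouched variables
of the block (at least `m + 1` of them, so the block's majority is forced to the right value
whatever the substituted variables carry, `majFn_eq_of_card_ne_le`); untouched blocks are wired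
through. Hence `gates(f) ≤ gates(f|_ρ) + m · gates(MAJ_{2m+1})`.
[cite: GolovnevHirschKnopKulikov2016, §3.2 (PDF p. 6) and proof of Thm. 3 (PDF p. 7)] -/
theorem circuitSizeOver_blockCompose_le_apply {m n : ℕ} (h : (Fin n → Bool) → Bool)
    (ρ : Substitution (Fin n × Fin (2 * m + 1))) (hρ : ρ.size ≤ m) :
    circuitSizeOver B2 (blockCompose h (majFn (2 * m + 1))) ≤
      circuitSizeOver B2 (ρ.apply (blockCompose h (majFn (2 * m + 1)))) +
        m * circuitSizeOver B2 (majFn (2 * m + 1)) := by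
  classical
  -- the touched blocks
  let T : Finset (Fin n) := ρ.R.image Prod.fst
  have hTcard : Fintype.card ↥T ≤ m := by
    rw [Fintype.card_coe]
    exact card_image_le.trans hρ
  -- stage 1: all variables passed through, plus one fresh gadget per touched block
  have h0 : CktSize B2 (fun (x : Fin n × Fin (2 * m + 1) → Bool) => x) 0 := CktSize.id B2
  have hg : CktSize B2 (fun (x : Fin n × Fin (2 * m + 1) → Bool) (t : ↥T) =>
      majFn (2 * m + 1) fun j => x ((t : Fin n), j))
      (Fintype.card ↥T * circuitSizeOver B2 (majFn (2 * m + 1))) :=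
    CktSize.pi_const fun t =>
      (cktSize_circuitSizeOver (majFn (2 * m + 1))).rewire fun j => ((t : Fin n), j)
  -- each remaining variable reads its block's gadget if the block is touched, itself otherwise
  let r : (↥(ρ.Rᶜ) : Type) → (Fin n × Fin (2 * m + 1)) ⊕ ↥T := fun v =>
    if hv : v.1.1 ∈ T then Sum.inr ⟨v.1.1, hv⟩ else Sum.inl v.1
  have h1 := (h0.pair hg).outMap r
  -- stage 2: an optimal circuit for `f|_ρ` on top
  have h2 := h1.comp (cktSize_circuitSizeOver (ρ.apply (blockCompose h (majFn (2 * m + 1)))))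
  -- the composite computes `f`
  have h3 : CktSize B2 (fun (x : Fin n × Fin (2 * m + 1) → Bool) (_ : Unit) =>
      blockCompose h (majFn (2 * m + 1)) x)
      (0 + Fintype.card ↥T * circuitSizeOver B2 (majFn (2 * m + 1)) +
        circuitSizeOver B2 (ρ.apply (blockCompose h (majFn (2 * m + 1))))) := by
    refine h2.congr fun x _ => ?_
    simp only [Substitution.apply, blockCompose]
    congr 1
    funext i
    by_cases hi : i ∈ T
    · -- touched block: the `≥ m + 1` untouched variables all carry `b`
      apply majFn_eq_of_card_ne_le
      calc (univ.filter fun j : Fin (2 * m + 1) => ρ.extend _ (i, j) ≠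
              majFn (2 * m + 1) fun j => x (i, j)).card
          ≤ (univ.filter fun j : Fin (2 * m + 1) => (i, j) ∈ ρ.R).card := by
            refine card_le_card fun j => ?_
            simp only [mem_filter, mem_univ, true_and]
            intro hj
            by_contra hij
            apply hj
            rw [Substitution.extend_of_not_mem _ _ hij]
            simp [r, hi]
        _ ≤ ρ.R.card :=
            card_le_card_of_injOn (fun j => (i, j)) (fun j hj => by simpa using hj)
              fun a _ b _ hab => by simpa using hab
        _ ≤ m := hρ
    · -- untouched block: wired through
      congr 1
      funext j
      have hij : (i, j) ∉ ρ.R := fun hij => hi (mem_image_of_mem Prod.fst hij)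
      rw [Substitution.extend_of_not_mem _ _ hij]
      simp [r, hi]
  have h4 := circuitSizeOver_le_of_cktSize h3
  have h5 : Fintype.card ↥T * circuitSizeOver B2 (majFn (2 * m + 1)) ≤
      m * circuitSizeOver B2 (majFn (2 * m + 1)) := Nat.mul_le_mul_right _ hTcard
  omega

/-- **GHKK Lemma 1 from the majority-gadget bound (proved reduction).** If `MAJ_{2m+1}` has
`B₂`-circuits with at most `9m + 4 = ⌊4.5(2m+1)⌋` gates for every `m ≥ 1` — "the majority of
`2m + 1` bits can be computed by a circuit of size `4.5(2m + 1)` [8]" (PDF p. 6; GHKK's [8]/[6]: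
Demenkov–Kojevnikov–Kulikov–Yaroslavtsev 2010, `4.5n + o(n)` for every symmetric function; the
bare bound follows from the bit-adder bound `size(SUM_n) ≤ 4.5n − 2⌈log₂(n+1)⌉` of
arXiv:2509.13966, Thm. 1, plus a `⌈log₂(n+1)⌉ − 1`-gate comparison) — then both printed
inequalities hold with the printed constants. [cite: GolovnevHirschKnopKulikov2016, §3.2 and Lemma 1 (PDF p. 6)] -/
theorem GateEliminationLimit_of_majority_bound
    (hmaj : ∀ m : ℕ, 0 < m → circuitSizeOver B2 (majFn (2 * m + 1)) ≤ 9 * m + 4) :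
    GateEliminationLimit := by
  intro m n hm h
  have hgR : (circuitSizeOver B2 (majFn (2 * m + 1)) : ℝ) ≤ 4.5 * (2 * m + 1) := by
    have h1 : ((circuitSizeOver B2 (majFn (2 * m + 1)) : ℕ) : ℝ) ≤ ((9 * m + 4 : ℕ) : ℝ) := by
      exact_mod_cast hmaj m hm
    push_cast at h1
    linarith
  refine ⟨?_, fun ρ hρ => ?_⟩
  · have h1 : ((circuitSizeOver B2 (blockCompose h (majFn (2 * m + 1))) : ℕ) : ℝ) ≤
        ((circuitSizeOver B2 h + n * circuitSizeOver B2 (majFn (2 * m + 1)) : ℕ) : ℝ) := by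
      exact_mod_cast circuitSizeOver_blockCompose_le h (majFn (2 * m + 1))
    push_cast at h1
    have h2 : (n : ℝ) * circuitSizeOver B2 (majFn (2 * m + 1)) ≤ n * (4.5 * (2 * m + 1)) :=
      mul_le_mul_of_nonneg_left hgR (Nat.cast_nonneg n)
    linarith
  · have h1 : ((circuitSizeOver B2 (blockCompose h (majFn (2 * m + 1))) : ℕ) : ℝ) ≤
        ((circuitSizeOver B2 (ρ.apply (blockCompose h (majFn (2 * m + 1)))) +
          m * circuitSizeOver B2 (majFn (2 * m + 1)) : ℕ) : ℝ) := by
      exact_mod_cast circuitSizeOver_blockCompose_le_apply h ρ hρ.le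
    push_cast at h1
    have h2 : (m : ℝ) * circuitSizeOver B2 (majFn (2 * m + 1)) ≤ m * (4.5 * (2 * m + 1)) :=
      mul_le_mul_of_nonneg_left hgR (Nat.cast_nonneg m)
    linarith

/-- Projections have circuit complexity `0` (the gate-free circuit `Circuit.input`). [folklore] -/
theorem circuitSizeOver_proj {α : Type} (i : α) :
    circuitSizeOver B2 (fun x : α → Bool => x i) = 0 :=
  Nat.eq_zero_of_le_zero (circuitSizeOver_le_of_computes (Circuit.input i)
    (fun g hg => by simp [Circuit.input] at hg) fun x => rfl)

/-- **Conversely, the fact pins the gadget bound**: at `n = 1` and `h = (x ↦ x 0)` (complexity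
`0`), `h ⋄ MAJ_{2m+1}` is `MAJ_{2m+1}` up to renaming its variables, so Lemma 1's second
inequality reads `gates(MAJ_{2m+1}) ≤ 4.5(2m+1)`, i.e. `≤ 9m + 4`. [cite: GolovnevHirschKnopKulikov2016, Lemma 1 (PDF p. 6)] -/
theorem GateEliminationLimit.majority_bound (hL : GateEliminationLimit) {m : ℕ} (hm : 0 < m) :
    circuitSizeOver B2 (majFn (2 * m + 1)) ≤ 9 * m + 4 := by
  have h1 := (hL m 1 hm fun x => x 0).1
  rw [circuitSizeOver_proj] at h1
  -- `MAJ` is `h ⋄ MAJ` with its variables `(0, j)` renamed to `j`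
  have h2 : circuitSizeOver B2 (majFn (2 * m + 1)) ≤
      circuitSizeOver B2 (blockCompose (fun x : Fin 1 → Bool => x 0) (majFn (2 * m + 1))) :=
    circuitSizeOver_le_of_cktSize (((cktSize_circuitSizeOver
      (blockCompose (fun x : Fin 1 → Bool => x 0) (majFn (2 * m + 1)))).rewire
        (ι' := Fin (2 * m + 1)) fun p => p.2).congr fun x _ => rfl)
  have h3 : ((circuitSizeOver B2 (majFn (2 * m + 1)) : ℕ) : ℝ) ≤
      ((circuitSizeOver B2 (blockCompose (fun x : Fin 1 → Bool => x 0) (majFn (2 * m + 1))) :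
        ℕ) : ℝ) := by
    exact_mod_cast h2
  push_cast at h1
  have h4 : ((circuitSizeOver B2 (majFn (2 * m + 1)) : ℕ) : ℝ) < ((9 * m + 5 : ℕ) : ℝ) := by
    push_cast
    linarith
  have h5 : circuitSizeOver B2 (majFn (2 * m + 1)) < 9 * m + 5 := by exact_mod_cast h4
  omega

/-- **`GateEliminationLimit` is equivalent to the majority-gadget bound** `gates(MAJ_{2m+1}) ≤
9m + 4` (`m ≥ 1`) over the tree's `B₂`. [cite: GolovnevHirschKnopKulikov2016, §3.2 and Lemma 1 (PDF p. 6)] -/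
theorem GateEliminationLimit_iff_majority_bound :
    GateEliminationLimit ↔ ∀ m : ℕ, 0 < m → circuitSizeOver B2 (majFn (2 * m + 1)) ≤ 9 * m + 4 :=
  ⟨fun hL _ hm => hL.majority_bound hm, GateEliminationLimit_of_majority_bound⟩

/-! ### The discharge: `GateEliminationLimit` holds

The remaining ingredient — a verified `B₂`-circuit family for `MAJ_{2m+1}` within `9m + 4`
gates — is `Literature.Computability.Complexity.circuitSizeOver_maj_le`
(`Literature/Computability/Complexity/MajorityCircuit.lean`): the MDFA carry-save counter of
Demenkov–Kojevnikov–Kulikov–Yaroslavtsev with an LSB-first comparator, `≤ 9m + 3` gates for every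
`m`. Plugged into `GateEliminationLimit_of_majority_bound` it proves Lemma 1 with its printed
constants, unconditionally. -/

/-- **Golovnev–Hirsch–Knop–Kulikov 2016, Lemma 1 — proved** (D-0014 discharge of the named fact
`GateEliminationLimit`): the printed reduction `GateEliminationLimit_of_majority_bound` fed with
the gadget bound `gates_{B₂}(MAJ_{2m+1}) ≤ 9m + 3 ≤ 4.5(2m+1)`
(`Literature.Computability.Complexity.circuitSizeOver_maj_le`, the `4.5n`-type symmetric-function
circuits of GHKK's ref. [6]/[8]). [cite: GolovnevHirschKnopKulikov2016, Lemma 1 (PDF p. 6)] -/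
theorem GateEliminationLimit_holds : GateEliminationLimit :=
  GateEliminationLimit_of_majority_bound fun m _ =>
    (Literature.Computability.Complexity.circuitSizeOver_maj_le m).trans (Nat.le_succ _)

end Literature.Barriers.PneNP

end
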